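import Literature.NumberTheory.LFunctions.LagariasDifferencedXiDefs
import Literature.NumberTheory.LFunctions.LagariasXiShiftHermiteBiehlerProofs
import Literature.NumberTheory.LFunctions.DirichletXiConjugation
import Literature.NumberTheory.LFunctions.GeneralizedRH
import Literature.Analysis.DeBrangesSpaces.Basic
import HarnessLib

/-!
# Zero spacings of Lagarias' differenced `ξ`- and `L`-functions (Lagarias 2005, §§4–6) — statements

LABEL (line 1): RH-FREE corpus typing. The numbered statements of §§4–6 of the source are typed AS
PRINTED: unproved published results as NAMED FACTS `def … : Prop` (D-0014; nothing is asserted —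
users take `(h : lagarias2005_…)`), the parts printed "Assuming the Riemann hypothesis" carry the
explicit binder `RiemannHypothesis → …` (resp. `χ.RiemannHypothesis → …` for `L(s, χ)`) and are
labelled RH-CONDITIONAL in their docstrings; Lemma 6.1 (i) is PROVED here (packaging of the tree
theorem `lagarias2005_lemma_2_1_holds`). bears_on: LADDER-RH B-C/B-P (COLUMN 6 DBR). WHAT THIS IS
NOT: formalising the statements of a printed paper about the differenced `ξ`-function is
transcription, not progress toward RH; no decl below is an RH-equivalent criterion; nothing here
bears on the truth of RH.

Source: J. C. Lagarias, *Zero spacing distributions for differenced L-functions*, Acta Arith. 120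
(2005) 159–184 = arXiv:math/0601653 [Lagarias2005] (held; locators `pNNNN:Lnn` = materialised arXiv
text): **Theorem 4.1** p0008:L71–87, **Lemma 4.1** p0008:L118–141, **Lemma 5.1** p0010:L28–36,
**Theorem 5.1** p0010:L85–100, **Theorem 5.2** p0010:L124–141, **Lemma 6.1** p0011:L139–147
(= arXiv p.11 "Lemma 6.1 (i), (ii)"). Objects of §2 (`A_{h,θ} = diffXiArot h θ`,
`B_{h,θ} = diffXiBrot h θ`, `critRePart`/`critImPart`, `critZeroOrdinates`, `AllZerosOnCriticalLine`,
`AllZerosSimple`, `CritZerosInterlace`) come from `LagariasDifferencedXiDefs.lean`; `ξ = riemannXi`;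
`ξ(s, χ) = (N/π)^{(s+k)/2} Γ((s+k)/2) L(s, χ)` ((5.1), p0010:L11–16) is EXACTLY the tree's
`DirichletTheta.dirichletXi χ` (`= N^{(s+κ)/2} · completedLFunction χ s`,
`DirichletLThetaRepresentation.lean`), CITED; "the Riemann hypothesis for `L(s, χ)`" is the tree's
`DirichletCharacter.RiemannHypothesis χ` (`GeneralizedRH.lean`); "de Branges structure function"
is `Literature.Analysis.DeBrangesSpaces.IsHermiteBiehler` (entire ∧ `‖E(z̄)‖ < ‖E(z)‖` on `Im z > 0`,
exactly (7.1) p0011:L196–197).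

## What is typed, and the printed-text issues recorded (referee read-points)

* §4: `R_h(T) := sup_{T ≤ t ≤ T+1} |ζ′/ζ(½ + h + it)|` (`zetaLogDerivSup`), Lemma 4.1 (1)–(3)
  (`lagarias2005_lemma_4_1_1/_2/_3`), the Odlyzko-normalised consecutive spacing
  `δ_n = (γ_{n+1} − γ_n) (1/2π) log(|γ_n|/2π)` (p0008:L37–40; `nextCritZero`, `normZeroSpacing`), the
  notion "the `k` consecutive normalised spacings have the trivial limiting distribution (delta mass
  at `(1,…,1)`)" (`HasTrivialSpacingDistribution`, typed as the equivalent counting statement: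
  for every `ε > 0` the proportion of zeros `γ` with `|γ| ≤ T` one of whose next `k` normalised
  spacings is `ε`-far from `1` tends to `0` — for a point-mass limit, weak convergence of the
  empirical laws is exactly this), Theorem 4.1 (1)/(2) (`lagarias2005_thm_4_1_1/_2`).
  (a) Lemma 4.1 (2) prints "`R_h(T) = O(log T / log log T)` for `|T| ≥ 2`"; the gauge is negative
  for `2 ≤ T < e`, so the literal `∀ |T| ≥ 2` reading is false; typed as `IsBigO` at `T → +∞` (the
  cited source [Titchmarsh1986, Thm 5.17 (5.17.4)] prints "for `t > A`"); negative `T` is the same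
  statement by `ζ(s̄) = conj ζ(s)`. (b) Lemma 4.1 (3) prints the range `0 < h ≤ ½`; at the endpoint
  `h = ½` it would assert `ζ′/ζ(1+it) = O(1)` under RH, which is false (`Ω(log log t)`; under RH the
  truth is `≪ log log t`, [Titchmarsh1986, Notes §14.33]); the cited source
  [Titchmarsh1986, Thm 14.5 (14.5.1)] covers `½ < σ₀ ≤ σ ≤ σ₁ < 1` only, so the fact is typed on the
  open range `0 < h < ½`. (c) Theorem 4.1 prints the tuple `(δ_n, …, δ_{n+k})` against the point
  `(x_1, …, x_k)`; typed with `k` consecutive spacings (as Theorem 5.2 words it).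
* §5: `E_h(s, χ) := ξ(s + h, χ)` (`diffXiCharE`), `E_{h,θ}(s, χ) := e^{iθ} ξ(s + h, χ)`
  (`diffXiCharErot`), `A_{h,θ}(s, χ)`, `B_{h,θ}(s, χ)` "given as in Lemma 2.2" (p0010:L75–83:
  `diffXiCharArot/Brot := critRePart/critImPart` of `E_{h,θ}(·, χ)`), Lemma 5.1 (1)/(2)
  (`lagarias2005_lemma_5_1_1/_2`), Theorem 5.1 (1)/(2) (`lagarias2005_thm_5_1_1/_2`), Theorem 5.2
  (1)/(2) (`lagarias2005_thm_5_2_1/_2`). Standing hypothesis of §5 made explicit: `χ` primitive of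
  conductor `N` AND non-principal (`χ ≠ 1`; Theorems 5.1/5.2 print it, Lemma 5.1's proof uses the
  entire Hadamard product (5.4), unavailable for `χ₀`; the `ζ` case is Lemma 2.1).
  (d) Lemma 5.1 (1) prints `|h| ≥ ½` and (2) "all nonzero `h`", but the inequality (5.3) REVERSES
  for `h ≤ −½` (functional equation + conjugation; for `ζ` numerically `ξ(2) < ξ(4)` refutes
  `h = −1`, `s = 3`), and Lemma 2.1, of which 5.1 is "similar", prints `h ≥ ½` / `h > 0`: typed with
  `½ ≤ h` / `0 < h`. Theorems 5.1/5.2 keep `|h|` as printed (the statements are invariant under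
  `h ↦ −h`, which replaces `E_{h,θ}` by a rotation of its reflection).
  NOT typed: the unnumbered zero-counting display p0010:L111–115 (the `χ`-analogue of Theorem 3.1,
  "holds with a similar proof") — not a numbered statement; the `ζ` case is Theorem 3.1
  (`LagariasDifferencedXi` statements module).
* §6: Lemma 6.1 (i) PROVED (`lagarias2005_lemma_6_1_i`, from `lagarias2005_lemma_2_1_holds`);
  Lemma 6.1 (ii) = Lemma 2.1 (2) in the `z`-variable, RH-CONDITIONAL named fact
  (`lagarias2005_lemma_6_1_ii`) + its `s`-variable form proved equivalent
  (`lagarias2005_lemma_6_1_ii_iff`). (e) (ii) prints "for all `h ≠ 0`" while Lemma 2.1 (2), of which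
  6.1 is declared "a restatement", prints `h > 0`; for `h < 0` the Hermite–Biehler inequality
  REVERSES (`norm_riemannXi_half_sub_sub`, PROVED) so `E_h` is not a structure function for any
  `h ≤ −½` (`not_isHermiteBiehler_xiShift_neg`, PROVED, RH-free) — typed with `0 < h`. The
  bookkeeping node "L6.1(iii)" of the cell's NODES list has no counterpart in the held arXiv text
  (Lemma 6.1 has parts (i), (ii) only): nothing typed under it.
* The de Branges dictionary of §6 (spaces `𝓗(E)`, the operator `(M_z, 𝒟_z)`, eigenfunctions (7.4))
  is narrative recalled from [La06]/[deB68] and is the business of `Literature.Analysis.DeBrangesSpaces`;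
  not typed here.

## References
* [Lagarias2005] J. C. Lagarias, Acta Arith. 120 (2005) 159–184 = arXiv:math/0601653, §§4–6.
* [Titchmarsh1986] E. C. Titchmarsh, *The theory of the Riemann zeta-function*, 2nd ed. (Heath-Brown),
  Thm 5.17 (5.17.4); Thm 14.5 (14.5.1); Notes §14.33.
-/

noncomputable section

open Complex Set Filter Asymptotics
open scoped Topology

namespace Literature.NumberTheory.LFunctions

/-! ## §4. Local spacing statistics: the objects -/

/-- `R_h(T) := sup_{T ≤ t ≤ T+1} |ζ′/ζ(½ + h + it)|` (p0008:L113–116). A real `sSup` over the image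
of `[T, T+1]`; in the regimes of Lemma 4.1 (`½ + h > 1`; `½ + h = 1`, `T` large; or RH and `h > 0`)
`ζ` has no zero or pole on the segment and the supremum is attained (continuity on a compact set);
elsewhere the value may be the junk `sSup` of an unbounded set (`= 0`), which no statement below
uses. [cite: Lagarias2005, §4 p.8 (definition of R_h(T))] -/
def zetaLogDerivSup (h T : ℝ) : ℝ :=
  sSup ((fun t : ℝ ↦ ‖deriv riemannZeta (1 / 2 + h + t * I) / riemannZeta (1 / 2 + h + t * I)‖) ''
    Icc T (T + 1))

/-- Unfolding of `zetaLogDerivSup`. [cite: Lagarias2005, §4 p.8] -/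
theorem zetaLogDerivSup_def (h T : ℝ) :
    zetaLogDerivSup h T = sSup ((fun t : ℝ ↦
      ‖deriv riemannZeta (1 / 2 + h + t * I) / riemannZeta (1 / 2 + h + t * I)‖) '' Icc T (T + 1)) :=
  rfl

/-- NAMED FACT **Lagarias 2005, Lemma 4.1 (1)** (RH-FREE): for `h > ½`, `R_h(T) = O(1)` with an
`O`-constant depending on `h` ("follows from logarithmic differentiation of the Euler product for
`ζ(s)`", i.e. `|ζ′/ζ(σ+it)| ≤ Σ Λ(n) n^{−σ}` for `σ = ½ + h > 1`). Dischargeable from Mathlib's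
von Mangoldt `L`-series. [cite: Lagarias2005, Lemma 4.1 (1) p.8] -/
def lagarias2005_lemma_4_1_1 : Prop :=
  ∀ h : ℝ, 1 / 2 < h → ∃ C : ℝ, ∀ T : ℝ, zetaLogDerivSup h T ≤ C

/-- NAMED FACT **Lagarias 2005, Lemma 4.1 (2)** (RH-FREE): for `h = ½`,
`R_{1/2}(T) = O(log T / log log T)` as `T → +∞` ("shown in Titchmarsh":
[Titchmarsh1986, Thm 5.17 (5.17.4)] `ζ′(1+it)/ζ(1+it) = O(log t / log log t)` for `t > A`). Printed
with "`|T| ≥ 2`": typed at `T → +∞` (`IsBigO atTop`), since the printed gauge is negative on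
`2 ≤ T < e`; `T → −∞` is the same statement by conjugation symmetry.
[cite: Lagarias2005, Lemma 4.1 (2) p.8] -/
def lagarias2005_lemma_4_1_2 : Prop :=
  (fun T : ℝ ↦ zetaLogDerivSup (1 / 2) T) =O[atTop] fun T : ℝ ↦ Real.log T / Real.log (Real.log T)

/-- NAMED FACT **Lagarias 2005, Lemma 4.1 (3)** (RH-CONDITIONAL, explicit binder): assuming the
Riemann hypothesis, for `0 < h < ½`, `R_h(T) = O((log T)^{1−2h})` as `T → +∞`, `O`-constant depending
on `h` ("shown in Titchmarsh": [Titchmarsh1986, Thm 14.5 (14.5.1)] `ζ′/ζ(s) = O((log t)^{2−2σ})`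
uniformly for `½ < σ₀ ≤ σ ≤ σ₁ < 1`, here `σ = ½ + h`). The printed range is `0 < h ≤ ½`; the
endpoint `h = ½` (`σ = 1`) is outside the cited theorem and would assert `ζ′/ζ(1+it) = O(1)`, whereas
under RH the truth is `≪ log log t` ([Titchmarsh1986, Notes §14.33]) and unconditionally
`ζ′/ζ(1+it) = Ω(log log t)`: the fact is typed on the open range.
[cite: Lagarias2005, Lemma 4.1 (3) p.8] -/
def lagarias2005_lemma_4_1_3 : Prop :=
  RiemannHypothesis → ∀ h : ℝ, 0 < h → h < 1 / 2 →
    (fun T : ℝ ↦ zetaLogDerivSup h T) =O[atTop] fun T : ℝ ↦ Real.log T ^ (1 - 2 * h)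

/-- The next zero ordinate of `F` on the critical line after `t`: `inf {γ ∈ critZeroOrdinates F : γ > t}`
(the `γ_{n+1}` following `γ_n = t` in the increasing enumeration of §4, p0008:L6–8). Junk value
`sInf ∅ = 0` if there is no larger zero ordinate. [cite: Lagarias2005, §4 p.8 (enumeration of zeros)] -/
def nextCritZero (F : ℂ → ℂ) (t : ℝ) : ℝ :=
  sInf {u : ℝ | u ∈ critZeroOrdinates F ∧ t < u}

/-- The (Odlyzko-)normalised spacing to the next zero,
`δ(γ) := (γ⁺ − γ) · (1/2π) · log(|γ|/2π)` (`δ_n = (γ_{n+1} − γ_n) (1/2π) log(|γ_n|/2π)`, p0008:L37–40;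
this is the normalisation Theorem 4.1 refers to, cf. p0009:L280–283).
[cite: Lagarias2005, §4 p.8 (definition of δ_n)] -/
def normZeroSpacing (F : ℂ → ℂ) (t : ℝ) : ℝ :=
  (nextCritZero F t - t) * (1 / (2 * Real.pi)) * Real.log (|t| / (2 * Real.pi))

/-- "The `k` consecutive normalised zero spacings of `F` have a limiting distribution as `T → ∞`,
namely the delta mass at `(1, 1, …, 1)` (the 'trivial' distribution)" (§4 p0008:L10–25 with the
normalisation `δ_n`, p0008:L54–66; conclusion of Theorems 4.1 and 5.2). The empirical law is the
uniform probability on the zeros `γ` with `|γ| ≤ T` (p0008:L19–21, L60–61) of the vector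
`(δ(γ), δ(γ⁺), …, δ(γ^{(k−1)+}))`; weak convergence of these laws to a point mass is equivalent to
convergence in probability, i.e. to the counting statement typed here: for every `ε > 0` the
proportion of zeros `γ`, `|γ| ≤ T`, for which some of the `k` spacings is `ε`-far from `1` tends
to `0`. (Ratio of `Set.ncard`s in `ℝ`; `0/0 = 0` only while no zero has `|γ| ≤ T`.)
[cite: Lagarias2005, §4 p.8 (limiting local spacing distribution)] -/
def HasTrivialSpacingDistribution (F : ℂ → ℂ) (k : ℕ) : Prop :=
  ∀ ε : ℝ, 0 < ε →
    Tendsto (fun T : ℝ ↦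
      (({t : ℝ | t ∈ critZeroOrdinates F ∧ |t| ≤ T ∧
          ∃ j : ℕ, j < k ∧ ε ≤ |normZeroSpacing F ((nextCritZero F)^[j] t) - 1|}.ncard : ℝ) /
        ({t : ℝ | t ∈ critZeroOrdinates F ∧ |t| ≤ T}.ncard : ℝ)))
      atTop (𝓝 0)

/-! ## §4. Theorem 4.1 -/

/-- NAMED FACT **Lagarias 2005, Theorem 4.1 (1)** (RH-FREE): let `k ≥ 1`; for `|h| ≥ ½` and
`0 ≤ θ < 2π` the functions `A_{h,θ}(s)` and `B_{h,θ}(s)` both have a limiting joint distribution, as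
`T → ∞`, of their `k` normalised consecutive zero spacings, and it is the delta mass at
`(1, 1, …, 1)` (the "trivial" distribution). (Printed tuple `(δ_n, …, δ_{n+k})` vs point
`(x_1, …, x_k)`: typed with `k` spacings, as in Theorem 5.2.)
[cite: Lagarias2005, Theorem 4.1 (1) p.8] -/
def lagarias2005_thm_4_1_1 : Prop :=
  ∀ k : ℕ, 1 ≤ k → ∀ h θ : ℝ, 1 / 2 ≤ |h| → 0 ≤ θ → θ < 2 * Real.pi →
    HasTrivialSpacingDistribution (diffXiArot h θ) k ∧
      HasTrivialSpacingDistribution (diffXiBrot h θ) k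

/-- NAMED FACT **Lagarias 2005, Theorem 4.1 (2)** (RH-CONDITIONAL, explicit binder): assuming the
Riemann hypothesis, the same holds for `0 < |h| < ½` and `0 ≤ θ < 2π`: the limiting distribution of
`k` normalised consecutive zero spacings of `A_{h,θ}` and of `B_{h,θ}` exists and is the trivial one.
[cite: Lagarias2005, Theorem 4.1 (2) p.8] -/
def lagarias2005_thm_4_1_2 : Prop :=
  RiemannHypothesis →
    ∀ k : ℕ, 1 ≤ k → ∀ h θ : ℝ, 0 < |h| → |h| < 1 / 2 → 0 ≤ θ → θ < 2 * Real.pi →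
      HasTrivialSpacingDistribution (diffXiArot h θ) k ∧
        HasTrivialSpacingDistribution (diffXiBrot h θ) k

/-! ## §5. Differenced Dirichlet `L`-functions: the objects

`ξ(s, χ)` is the tree's `DirichletTheta.dirichletXi χ` (same normalisation as (5.1)). -/

section Dirichlet

variable {N : ℕ} [NeZero N]

/-- `E_h(s, χ) := ξ(s + h, χ)` (Lemma 5.1), over the tree's completed `L`-function
`DirichletTheta.dirichletXi χ s = (N/π)^{(s+κ)/2} Γ((s+κ)/2) L(s, χ)` = (5.1).
[cite: Lagarias2005, Lemma 5.1 (statement) p.10] -/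
def diffXiCharE (χ : DirichletCharacter ℂ N) (h : ℝ) (s : ℂ) : ℂ :=
  DirichletTheta.dirichletXi χ (s + h)

/-- `E_{h,θ}(s, χ) := e^{iθ} ξ(s + h, χ)` (p0010:L77–79). [cite: Lagarias2005, §5 p.10 (E_{h,θ}(s,χ))] -/
def diffXiCharErot (χ : DirichletCharacter ℂ N) (h θ : ℝ) (s : ℂ) : ℂ :=
  Complex.exp (θ * I) * DirichletTheta.dirichletXi χ (s + h)

/-- `A_{h,θ}(s, χ)`, "given as in Lemma 2.2" from `E_{h,θ}(s, χ) = A_{h,θ}(s,χ) − i B_{h,θ}(s,χ)`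
(p0010:L77–83): `A = ½(E + E♯)` with `E♯(s) = conj E(1 − s̄)`. [cite: Lagarias2005, §5 p.10 (A_{h,θ}(s,χ))] -/
def diffXiCharArot (χ : DirichletCharacter ℂ N) (h θ : ℝ) : ℂ → ℂ :=
  critRePart (diffXiCharErot χ h θ)

/-- `B_{h,θ}(s, χ)`, "given as in Lemma 2.2": `B = −(1/2i)(E − E♯)`.
[cite: Lagarias2005, §5 p.10 (B_{h,θ}(s,χ))] -/
def diffXiCharBrot (χ : DirichletCharacter ℂ N) (h θ : ℝ) : ℂ → ℂ :=
  critImPart (diffXiCharErot χ h θ)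

/-- Unfolding of `diffXiCharE`. [cite: Lagarias2005, Lemma 5.1 (statement) p.10] -/
theorem diffXiCharE_apply (χ : DirichletCharacter ℂ N) (h : ℝ) (s : ℂ) :
    diffXiCharE χ h s = DirichletTheta.dirichletXi χ (s + h) := rfl

/-- `E_{h,θ}(·, χ) = e^{iθ} E_h(·, χ)`. [cite: Lagarias2005, §5 p.10] -/
theorem diffXiCharErot_apply (χ : DirichletCharacter ℂ N) (h θ : ℝ) (s : ℂ) :
    diffXiCharErot χ h θ s = Complex.exp (θ * I) * diffXiCharE χ h s := rfl

/-- `E_{h,θ}(s, χ) = A_{h,θ}(s, χ) − i B_{h,θ}(s, χ)` (p0010:L79). [cite: Lagarias2005, §5 p.10] -/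
theorem diffXiCharErot_eq_sub (χ : DirichletCharacter ℂ N) (h θ : ℝ) (s : ℂ) :
    diffXiCharErot χ h θ s = diffXiCharArot χ h θ s - I * diffXiCharBrot χ h θ s :=
  (critRePart_sub_I_mul_critImPart _ s).symm

/-- `A_{h,θ}(s, χ)` is real on the critical line. [cite: Lagarias2005, §5 p.10] -/
theorem im_diffXiCharArot_critical (χ : DirichletCharacter ℂ N) (h θ t : ℝ) :
    (diffXiCharArot χ h θ (1 / 2 + t * I)).im = 0 := by
  rw [diffXiCharArot, critRePart_critical]
  simp

/-- `B_{h,θ}(s, χ)` is real on the critical line. [cite: Lagarias2005, §5 p.10] -/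
theorem im_diffXiCharBrot_critical (χ : DirichletCharacter ℂ N) (h θ t : ℝ) :
    (diffXiCharBrot χ h θ (1 / 2 + t * I)).im = 0 := by
  rw [diffXiCharBrot, critImPart_critical]
  simp

/-- The reflection of `E_h(·, χ)` for a primitive `χ ≠ 1`:
`E_h♯(s, χ) = conj ξ(1 − s̄ + h, χ) = conj(ε(χ)) · ξ(s − h, χ)` (by the tree's
`dirichletXi_one_sub_conj : ξ(1 − s̄, χ) = ε(χ) conj ξ(s, χ)`), the `χ`-analogue of
`critReflect_diffXiE : E_h♯(s) = ξ(s − h)`. [cite: Lagarias2005, §5 p.10 (proof of Lemma 5.1)] -/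
theorem critReflect_diffXiCharE {χ : DirichletCharacter ℂ N} (hχ : χ.IsPrimitive) (h1 : χ ≠ 1)
    (h : ℝ) (s : ℂ) :
    critReflect (diffXiCharE χ h) s =
      (starRingEnd ℂ) χ.rootNumber * DirichletTheta.dirichletXi χ (s - h) := by
  rw [critReflect_apply, diffXiCharE_apply]
  have e : (1 : ℂ) - (starRingEnd ℂ) s + h = 1 - (starRingEnd ℂ) (s - h) := by
    simp only [map_sub, Complex.conj_ofReal]; ring
  rw [e, DirichletTheta.dirichletXi_one_sub_conj hχ h1, map_mul, Complex.conj_conj]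

/-- `E_h(·, χ)` is entire (`χ ≠ 1`). [cite: Lagarias2005, §5 p.10] -/
theorem differentiable_diffXiCharE {χ : DirichletCharacter ℂ N} (h1 : χ ≠ 1) (h : ℝ) :
    Differentiable ℂ (diffXiCharE χ h) :=
  (DirichletTheta.differentiable_dirichletXi h1).comp (differentiable_id.add (differentiable_const _))

/-- `E_{h,θ}(·, χ)` is entire (`χ ≠ 1`). [cite: Lagarias2005, §5 p.10] -/
theorem differentiable_diffXiCharErot {χ : DirichletCharacter ℂ N} (h1 : χ ≠ 1) (h θ : ℝ) :
    Differentiable ℂ (diffXiCharErot χ h θ) :=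
  (differentiable_const _).mul (differentiable_diffXiCharE h1 h)

end Dirichlet

/-! ## §5. Lemma 5.1, Theorems 5.1 and 5.2 -/

/-- NAMED FACT **Lagarias 2005, Lemma 5.1 (1)** (RH-FREE): for a primitive non-principal Dirichlet
character `χ` of conductor `N` and `h ≥ ½`, `E_h(s, χ) := ξ(s + h, χ)` satisfies
`|E_h(s, χ)| > |E_h(1 − s̄, χ)|` for `Re(s) > ½` ((5.3); proof "similar to Lemma 2.1", via the
modified Hadamard product (5.4) and `Re B*(χ) ≥ 0`). Printed with `|h| ≥ ½`; typed with `h ≥ ½`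
(for `h ≤ −½` the inequality reverses — see the module docstring, item (d) — and Lemma 2.1 (1)
prints `h ≥ ½`). [cite: Lagarias2005, Lemma 5.1 (1) p.10] -/
def lagarias2005_lemma_5_1_1 : Prop :=
  ∀ (N : ℕ) [NeZero N] (χ : DirichletCharacter ℂ N), χ.IsPrimitive → χ ≠ 1 →
    ∀ h : ℝ, 1 / 2 ≤ h → ∀ s : ℂ, 1 / 2 < s.re →
      ‖diffXiCharE χ h (1 - (starRingEnd ℂ) s)‖ < ‖diffXiCharE χ h s‖

/-- NAMED FACT **Lagarias 2005, Lemma 5.1 (2)** (GRH(χ)-CONDITIONAL, explicit binder): assuming the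
Riemann hypothesis for `ξ(s, χ)` (`χ` primitive, non-principal), the inequality (5.3)
`|E_h(s, χ)| > |E_h(1 − s̄, χ)|`, `Re(s) > ½`, holds for every `h > 0`. Printed "for all nonzero
`h`"; typed with `h > 0` as in Lemma 2.1 (2) (the inequality reverses for negative `h`).
[cite: Lagarias2005, Lemma 5.1 (2) p.10] -/
def lagarias2005_lemma_5_1_2 : Prop :=
  ∀ (N : ℕ) [NeZero N] (χ : DirichletCharacter ℂ N), χ.IsPrimitive → χ ≠ 1 → χ.RiemannHypothesis →
    ∀ h : ℝ, 0 < h → ∀ s : ℂ, 1 / 2 < s.re →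
      ‖diffXiCharE χ h (1 - (starRingEnd ℂ) s)‖ < ‖diffXiCharE χ h s‖

/-- NAMED FACT **Lagarias 2005, Theorem 5.1 (1)** (RH-FREE): let `χ` be a primitive non-principal
Dirichlet character. For `|h| ≥ ½` and any `0 ≤ θ < 2π` the entire functions `A_{h,θ}(s, χ)` and
`B_{h,θ}(s, χ)` have all their zeros on the critical line `Re(s) = ½`; these zeros are all simple,
and they interlace. [cite: Lagarias2005, Theorem 5.1 (1) p.10] -/
def lagarias2005_thm_5_1_1 : Prop :=
  ∀ (N : ℕ) [NeZero N] (χ : DirichletCharacter ℂ N), χ.IsPrimitive → χ ≠ 1 →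
    ∀ h θ : ℝ, 1 / 2 ≤ |h| → 0 ≤ θ → θ < 2 * Real.pi →
      AllZerosOnCriticalLine (diffXiCharArot χ h θ) ∧ AllZerosOnCriticalLine (diffXiCharBrot χ h θ) ∧
        AllZerosSimple (diffXiCharArot χ h θ) ∧ AllZerosSimple (diffXiCharBrot χ h θ) ∧
          CritZerosInterlace (diffXiCharArot χ h θ) (diffXiCharBrot χ h θ)

/-- NAMED FACT **Lagarias 2005, Theorem 5.1 (2)** (GRH(χ)-CONDITIONAL, explicit binder): assuming
the Riemann hypothesis for `L(s, χ)` (`χ` primitive, non-principal), for `0 < |h| < ½` and any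
`0 ≤ θ < 2π` the functions `A_{h,θ}(s, χ)`, `B_{h,θ}(s, χ)` have all their zeros on `Re(s) = ½`,
all simple, and interlacing. [cite: Lagarias2005, Theorem 5.1 (2) p.10] -/
def lagarias2005_thm_5_1_2 : Prop :=
  ∀ (N : ℕ) [NeZero N] (χ : DirichletCharacter ℂ N), χ.IsPrimitive → χ ≠ 1 → χ.RiemannHypothesis →
    ∀ h θ : ℝ, 0 < |h| → |h| < 1 / 2 → 0 ≤ θ → θ < 2 * Real.pi →
      AllZerosOnCriticalLine (diffXiCharArot χ h θ) ∧ AllZerosOnCriticalLine (diffXiCharBrot χ h θ) ∧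
        AllZerosSimple (diffXiCharArot χ h θ) ∧ AllZerosSimple (diffXiCharBrot χ h θ) ∧
          CritZerosInterlace (diffXiCharArot χ h θ) (diffXiCharBrot χ h θ)

/-- NAMED FACT **Lagarias 2005, Theorem 5.2 (1)** (RH-FREE): let `χ` be a primitive non-principal
Dirichlet character and `k ≥ 1`. For `|h| ≥ ½` and `0 ≤ θ < 2π` the functions `A_{h,θ}(s, χ)` and
`B_{h,θ}(s, χ)` both have limiting distributions of their `k` consecutive normalised zero spacings,
namely the delta mass at `1` (at `(1, …, 1)`), the "trivial" distribution.
[cite: Lagarias2005, Theorem 5.2 (1) p.10] -/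
def lagarias2005_thm_5_2_1 : Prop :=
  ∀ (N : ℕ) [NeZero N] (χ : DirichletCharacter ℂ N), χ.IsPrimitive → χ ≠ 1 →
    ∀ k : ℕ, 1 ≤ k → ∀ h θ : ℝ, 1 / 2 ≤ |h| → 0 ≤ θ → θ < 2 * Real.pi →
      HasTrivialSpacingDistribution (diffXiCharArot χ h θ) k ∧
        HasTrivialSpacingDistribution (diffXiCharBrot χ h θ) k

/-- NAMED FACT **Lagarias 2005, Theorem 5.2 (2)** (GRH(χ)-CONDITIONAL, explicit binder): assuming
the Riemann hypothesis for `L(s, χ)`, the same holds for `0 < |h| < ½` and `0 ≤ θ < 2π`: the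
limiting distribution of `k` consecutive normalised zero spacings exists and is the trivial one.
[cite: Lagarias2005, Theorem 5.2 (2) p.10] -/
def lagarias2005_thm_5_2_2 : Prop :=
  ∀ (N : ℕ) [NeZero N] (χ : DirichletCharacter ℂ N), χ.IsPrimitive → χ ≠ 1 → χ.RiemannHypothesis →
    ∀ k : ℕ, 1 ≤ k → ∀ h θ : ℝ, 0 < |h| → |h| < 1 / 2 → 0 ≤ θ → θ < 2 * Real.pi →
      HasTrivialSpacingDistribution (diffXiCharArot χ h θ) k ∧
        HasTrivialSpacingDistribution (diffXiCharBrot χ h θ) k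

/-! ## §6. Lemma 6.1: `E_h(z) = ξ(½ + h − iz)` as a de Branges structure function -/

/-- **Lagarias 2005, Lemma 6.1 (i)** (RH-FREE, PROVED): for `h ≥ ½` the function
`E_h(z) := ξ(½ + h − iz)` is a de Branges structure function, i.e. it is entire and
`|E_h(z)| > |E_h(z̄)|` for `Im z > 0` — in the tree's vocabulary, `IsHermiteBiehler`. ("This is a
restatement of Lemma 2.1": the tree theorem `lagarias2005_lemma_2_1_holds` and its `z`-variable
form `lagarias2005_lemma_2_1.structureFunction`.) [cite: Lagarias2005, Lemma 6.1 (i) p.11] -/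
theorem lagarias2005_lemma_6_1_i {h : ℝ} (hh : 1 / 2 ≤ h) :
    Literature.Analysis.DeBrangesSpaces.IsHermiteBiehler (fun z : ℂ ↦ riemannXi (1 / 2 + h - I * z)) where
  differentiable :=
    differentiable_riemannXi.comp ((differentiable_const _).sub ((differentiable_const _).mul
      differentiable_id))
  norm_conj_lt := fun _ hz ↦ lagarias2005_lemma_2_1_holds.structureFunction hh hz

/-- NAMED FACT **Lagarias 2005, Lemma 6.1 (ii)** (RH-CONDITIONAL, explicit binder): if the Riemann
hypothesis holds, then for all `h > 0` the function `E_h(z) = ξ(½ + h − iz)` is a de Branges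
structure function (= Lemma 2.1 (2) under `s = ½ − iz`). Printed "for all `h ≠ 0`"; for `h < 0`
the inequality reverses (`norm_riemannXi_half_sub_sub`) and `E_h` is NOT a structure function for
any `h ≤ −½` (`not_isHermiteBiehler_xiShift_neg`, RH-free), while Lemma 2.1 (2), of which 6.1 is
"a restatement", prints `h > 0`: typed with `0 < h`. Dischargeable by the term-by-term Hadamard
product comparison of Lemma 2.1 with `β = ½ < h + ½` (cf. `LagariasXiShiftHermiteBiehlerProofs`).
[cite: Lagarias2005, Lemma 6.1 (ii) p.11] -/
def lagarias2005_lemma_6_1_ii : Prop :=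
  RiemannHypothesis → ∀ h : ℝ, 0 < h →
    Literature.Analysis.DeBrangesSpaces.IsHermiteBiehler (fun z : ℂ ↦ riemannXi (1 / 2 + h - I * z))

/-- The change of variable `s = ½ − iz`: the structure-function inequality for `E_h` on `Im z > 0`
is the inequality `|ξ(h + s)| > |ξ(h + 1 − s̄)|` on `Re s > ½` (Lemma 2.1 ⟷ Lemma 6.1, "this is a
restatement"). [cite: Lagarias2005, Lemma 6.1 (proof) p.11] -/
theorem xiShift_structureFunction_iff (h : ℝ) :
    (∀ z : ℂ, 0 < z.im →
        ‖riemannXi (1 / 2 + h - I * (starRingEnd ℂ) z)‖ < ‖riemannXi (1 / 2 + h - I * z)‖) ↔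
      ∀ s : ℂ, 1 / 2 < s.re → ‖riemannXi (h + 1 - (starRingEnd ℂ) s)‖ < ‖riemannXi (h + s)‖ := by
  constructor
  · intro H s hs
    -- `s = ½ − iz` with `z = i (s − ½)`, `Im z = Re s − ½ > 0`
    have hz : 0 < (I * (s - 1 / 2)).im := by simp; linarith
    have key := H (I * (s - 1 / 2)) hz
    have e1 : (1 / 2 : ℂ) + h - I * (starRingEnd ℂ) (I * (s - 1 / 2)) = h + 1 - (starRingEnd ℂ) s := by
      simp only [map_mul, Complex.conj_I, map_sub, map_div₀, map_one, map_ofNat]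
      ring_nf
      rw [Complex.I_sq]
      ring
    have e2 : (1 / 2 : ℂ) + h - I * (I * (s - 1 / 2)) = h + s := by
      ring_nf
      rw [Complex.I_sq]
      ring
    rwa [e1, e2] at key
  · intro H z hz
    have hs : (1 / 2 : ℝ) < ((1 / 2 : ℂ) - I * z).re := by simp [hz]
    have key := H ((1 / 2 : ℂ) - I * z) hs
    have e1 : (h : ℂ) + 1 - (starRingEnd ℂ) ((1 / 2 : ℂ) - I * z) =
        1 / 2 + h - I * (starRingEnd ℂ) z := by
      simp only [map_sub, map_mul, Complex.conj_I, map_div₀, map_one, map_ofNat]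
      ring
    have e2 : (h : ℂ) + ((1 / 2 : ℂ) - I * z) = 1 / 2 + h - I * z := by ring
    rwa [e1, e2] at key

/-- Lemma 6.1 (ii) in the `s`-variable is exactly **Lemma 2.1 (2)**: under RH, for every `h > 0`,
`|ξ(h + s)| > |ξ(h + 1 − s̄)|` for `Re(s) > ½` (PROVED equivalence of the two printed forms; both
remain RH-CONDITIONAL named statements). [cite: Lagarias2005, Lemma 2.1 (2) p.4; Lemma 6.1 (ii) p.11] -/
theorem lagarias2005_lemma_6_1_ii_iff :
    lagarias2005_lemma_6_1_ii ↔
      (RiemannHypothesis → ∀ h : ℝ, 0 < h → ∀ s : ℂ, 1 / 2 < s.re →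
        ‖riemannXi (h + 1 - (starRingEnd ℂ) s)‖ < ‖riemannXi (h + s)‖) := by
  refine ⟨fun H hRH h hh ↦ (xiShift_structureFunction_iff h).1 (H hRH h hh).norm_conj_lt,
    fun H hRH h hh ↦ ⟨?_, (xiShift_structureFunction_iff h).2 (H hRH h hh)⟩⟩
  exact differentiable_riemannXi.comp ((differentiable_const _).sub ((differentiable_const _).mul
    differentiable_id))

/-- Reversal under `h ↦ −h` (RH-FREE): `|E_{−h}(z)| = |E_h(z̄)|`, i.e.
`|ξ(½ − h − iz)| = |ξ(½ + h − i z̄)|`, from `ξ(s) = ξ(1 − s)` and `ξ(s̄) = conj ξ(s)`. Hence the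
structure-function inequality for `E_{−h}` is the REVERSE of the one for `E_h`.
[cite: Lagarias2005, §2 p.5 (ξ(s−h) = conj ξ(s+h) symmetry); Lemma 6.1 p.11] -/
theorem norm_riemannXi_half_sub_sub (h : ℝ) (z : ℂ) :
    ‖riemannXi (1 / 2 - h - I * z)‖ = ‖riemannXi (1 / 2 + h - I * (starRingEnd ℂ) z)‖ := by
  have e1 : riemannXi (1 / 2 - h - I * z) = riemannXi (1 / 2 + h + I * z) := by
    rw [← riemannXi_one_sub]; congr 1; ring
  have e2 : riemannXi (1 / 2 + h - I * (starRingEnd ℂ) z) =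
      (starRingEnd ℂ) (riemannXi (1 / 2 + h + I * z)) := by
    rw [← riemannXi_conj_holds]
    congr 1
    simp only [map_add, map_mul, Complex.conj_I, Complex.conj_ofReal, map_div₀, map_one, map_ofNat]
    ring
  rw [e1, e2, Complex.norm_conj]

/-- For `h ≥ ½` the reflected shift `E_{−h}(z) = ξ(½ − h − iz)` is NOT a de Branges structure
function (RH-FREE, PROVED): its inequality on `Im z > 0` is the reverse of Lemma 6.1 (i)'s. This is
why Lemma 6.1 (ii)'s printed quantifier "all `h ≠ 0`" must be read `h > 0` (= Lemma 2.1 (2)).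
[cite: Lagarias2005, Lemma 6.1 p.11 (with Lemma 2.1 p.4)] -/
theorem not_isHermiteBiehler_xiShift_neg {h : ℝ} (hh : 1 / 2 ≤ h) :
    ¬ Literature.Analysis.DeBrangesSpaces.IsHermiteBiehler
      (fun z : ℂ ↦ riemannXi (1 / 2 + (((-h : ℝ)) : ℂ) - I * z)) := by
  intro H
  have h1 := H.norm_conj_lt I (by simp)
  have hpos := (lagarias2005_lemma_6_1_i hh).norm_conj_lt I (by simp)
  simp only [Complex.ofReal_neg, ← sub_eq_add_neg] at h1
  rw [norm_riemannXi_half_sub_sub, norm_riemannXi_half_sub_sub, Complex.conj_conj] at h1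
  exact lt_asymm h1 hpos

end Literature.NumberTheory.LFunctions
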